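import Summits.NavierStokesRegularity.NavierStokesRegularity.Theses.LevelSetModeration
import Summits.NavierStokesRegularity.NavierStokesRegularity.Theorems.Target.Negative.NormalForms
import Literature.Analysis.FluidPDE.NSQuasipotential
import Literature.Analysis.FluidPDE.NormalisedPressureAffine
import Literature.Analysis.FluidPDE.ClassicalSolutionRescale
import Literature.Analysis.FluidPDE.LerayHopfNSRescale
import Literature.Analysis.FluidPDE.NSLerayHopfABCScaling

/-!
# Disproof work file — crux `HighSpeedPressureWork` (stmt-NavierStokesRegularity-18149,
# route `LevelSetModeration`, rank 2)

Standing adversary refuter-cdisprove-stmt-NavierStokesRegularity-18149-0, cycle 1 (2026-08-17).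
Builds on the crux-attack r1 note `CRUX-ATTACK-r1.md` (verdict there: survives A1–A6, junk-free,
regularity-complete). Everything not marked `sorry` is `lean check`ed with standard axioms.

## Findings (index)
* §0 Vocabulary: `pressureWork`, `highSetMeasure`, `speedDissipation`, the fibre
  `HSPWWith ν T m F` and `highSpeedPressureWork_iff` (definitional unfolding of the crux).
* §1 NOT LOAD-BEARING — the exponent constraint `m < 10/3` modulo an a priori speed bound:
  `hspwWith_exponent_collapse` / `highSpeedPressureWork_of_aprioriSpeedBound`: if the data class
  `(ν, T, E₀, B₀)` carries a uniform bound `‖u‖ ≤ G(E₀, B₀)` on `[0, T) × ℝ³`, then the crux with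
  ANY exponent `m₀ ≥ 0` (e.g. the planner's "generic" `m = 4`, or `m = 100`) implies the crux with
  exponent `0`, hence `HighSpeedPressureWork`: above `2 G` the super-level sets are empty and both
  sides vanish (`pressureWork_eq_zero_of_speed_lt`), below it `M ^ m₀ ≤ (2G+1)^{m₀}` is absorbed
  by the modulus. So the advertised `2/3`-gain in the exponent is not where the difficulty sits:
  at fixed data bounds the exponent only measures growth in the AMPLIFICATION `M / B₀`, i.e. the
  crux is (uniform quantitative) regularity in disguise (consistent with r1's "restates" probe).
* §2 TIGHTNESS of the data modulus under Leray's similarity (scaling laws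
  `pressureWork_nsRescale`, `highSetMeasure_nsRescale`, `speedDissipation_nsRescale`):
  along `u ↦ λu(λ²·, λ·)` the three functionals scale like `λ⁻¹, λ⁻⁵, λ⁻¹`, so the inequality
  rescales to `PW ≤ λ^{(m-4)/2} √(F(E₀/λ, λB₀) M^m V) √D` (`hspwWith_scaling`): any admissible
  modulus must grow at least like `λ^{4-m}` along every scaling orbit through an overshooting
  global solution (`modulus_growth_of_overshoot`), and the DATA-UNIFORM strengthening
  (`F` constant) with any `m < 4` is refuted modulo the existence of one overshooting global
  solution (`not_hspwWith_const_of_overshoot`).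
* §3 Near-misses / why it resists (section docblock): early-time multi-scale data give
  `p̃ ~ B₀² log N` at the speed maximum (BMO is sharp for div-free fields) but the moderation
  identity removes it; swirl spin-up and thin sheets give `PW²/(V D) ≲ s_max⁴/ν²`, absorbed by
  `F` unless the amplification `s_max/B₀` is unbounded at fixed `(E₀,B₀,ν,T)` = blow-up regime.
* §4 `speedDissipation_le_of_hspwWith`: modulo the route's `LevelSetEnergyInequality` the crux
  forces the PRESSURE-FREE Caccioppoli form `ν D_c(t) ≤ √(F M^m V_c(T)) √(D_c(T))` — a cleaner
  target for future attacks (thin fast structures).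
* §5 Adversary normal forms `not_highSpeedPressureWork_iff`, `not_hspwWith_iff`.
* §6 TARGETS — line `Sketch` (comoving head ceiling): triage of the seven registered stubs (six
  true infrastructure; `stub_comovingBudget` crux-complete, inherits §§1–2; mechanism reading:
  through-flow carries the ceiling, swirling cores carry an `O(M²)` deficit so the bet is small
  deceleration flux of fast cores — adversarial scenario = non-axisymmetric cores / reconnection
  at large amplification; far-field ceiling pumping is absorbed but makes the stub stronger than
  the crux).
NOTE (§4): the tree meanwhile has the stronger `levelSetModeration_highSpeedDissipation_le`
(`…DissipationBound.lean`, p144625: `t ↑ T` and the squared law `ν² D_c(T) ≤ F⁺ M^m V_c(T)`) and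
`highSpeedPressureWork_speedGradientLaw` (`…Consequences.lean`, p144111); `LevelSetEnergyInequality`
is PROVED (stmt-18151), so §4 is unconditional — the draft `Negative/CaccioppoliConsequence.lean`
is withdrawn as a duplicate.

## Landed (Negative/ lane, `--supports` stmt-18149; namespace `…Theorems.HighSpeedPressureWork.Negative`,
## same declaration names as here — a later generation should switch this file to importing them)
* p145610 ACCEPTED `Theorems/HighSpeedPressureWork/Negative/ExponentCollapse.lean` (§§0–1).
* p147248 ACCEPTED `Theorems/HighSpeedPressureWork/Negative/ScalingTightness.lean` (§2 incl.
  `modulus_lower_bound_of_overshoot`).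
* §4 is NOT landed separately: the tree's `…HighSpeedPressureWorkDissipationBound.lean` (p144625)
  and `…HighSpeedPressureWorkConsequences.lean` (p144111) already carry the stronger form.
-/

noncomputable section

open MeasureTheory TopologicalSpace Set Function Filter Metric
open scoped Topology RealInnerProductSpace ContDiff InnerProductSpace ENNReal
open Literature.Analysis.FluidPDE
open Summit.NavierStokesRegularity.NavierStokesRegularity.Theses.LevelSetModeration

set_option linter.dupNamespace false

namespace Summit.NavierStokesRegularity.NavierStokesRegularity.Cruxes.HighSpeedPressureWork.Disproof

/-- Local notation for physical space `ℝ³ = EuclideanSpace ℝ (Fin 3)`. -/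
local notation "ℝ³" => EuclideanSpace ℝ (Fin 3)

/-! ## §0 Vocabulary -/

/-- The LHS of the crux: the (minus) pressure work on the super-level set `{|u| > c}` up to time
`t`, `PW_c(t) = -∫₀ᵗ∫ (1 - c/|u|)₊ u·∇p̃`. -/
def pressureWork (u : ℝ → ℝ³ → ℝ³) (c t : ℝ) : ℝ :=
  -(∫ τ in Set.Ioo 0 t, ∫ x, max (1 - c / ‖u τ x‖) 0 *
      (fderiv ℝ (normalisedPressure (u τ)) x (u τ x)))

/-- The space–time measure of the high-speed set, `V_c(T) = ∫₀ᵀ |{|u(τ)| > c}| dτ` (real part). -/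
def highSetMeasure (u : ℝ → ℝ³ → ℝ³) (c T : ℝ) : ℝ :=
  (∫⁻ τ in Set.Ioo 0 T, volume {x | c < ‖u τ x‖}).toReal

/-- The level-set dissipation of the speed, `D_c(T) = ∫₀ᵀ∫ 1_{|u|>c} |∇|u||²` (real part). -/
def speedDissipation (u : ℝ → ℝ³ → ℝ³) (c T : ℝ) : ℝ :=
  (∫⁻ τ in Set.Ioo 0 T, ∫⁻ x, Set.indicator {x | c < ‖u τ x‖}
      (fun x => ENNReal.ofReal (‖fderiv ℝ (fun y => ‖u τ y‖) x‖ ^ 2)) x).toReal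

/-- The crux on the fibre `(ν, T)` with a FIXED exponent `m` and modulus `F`. -/
def HSPWWith (ν T m : ℝ) (F : ℝ → ℝ → ℝ) : Prop :=
  ∀ (u : ℝ → ℝ³ → ℝ³) (p : ℝ → ℝ³ → ℝ),
    IsClassicalNSSolutionOn (Set.Ico 0 T) ν 0 u p → IsLerayHopfOn T ν 0 (u 0) u →
    HasRapidSpatialDecay (u 0) →
    ∀ (E₀ B₀ : ℝ), (∫ x, ‖u 0 x‖ ^ 2) ≤ E₀ → (∀ x, ‖u 0 x‖ ≤ B₀) →
    ∀ (M c t : ℝ), 2 * B₀ ≤ M → M / 2 ≤ c → c ≤ M → 0 < c → t ∈ Set.Ico 0 T →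
    pressureWork u c t ≤
      Real.sqrt (F E₀ B₀ * M ^ m * highSetMeasure u c T) * Real.sqrt (speedDissipation u c T)

/-- The crux, fibrewise (definitional unfolding). -/
theorem highSpeedPressureWork_iff :
    HighSpeedPressureWork ↔
      ∀ (ν T : ℝ), 0 < ν → 0 < T → ∃ m : ℝ, m < 10 / 3 ∧ ∃ F : ℝ → ℝ → ℝ, HSPWWith ν T m F :=
  Iff.rfl

/-- If the speed stays strictly below the level `c` on `(0, t) × ℝ³`, the pressure work on
`{|u| > c}` vanishes (the weight `(1 - c/|u|)₊` is zero; at stagnation points the junk weight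
`1` is killed by `fderiv … x 0 = 0`). -/
theorem pressureWork_eq_zero_of_speed_lt {u : ℝ → ℝ³ → ℝ³} {c t : ℝ}
    (h : ∀ τ ∈ Set.Ioo 0 t, ∀ x, ‖u τ x‖ < c) : pressureWork u c t = 0 := by
  have hinner : ∀ τ ∈ Set.Ioo 0 t,
      (∫ x, max (1 - c / ‖u τ x‖) 0 * (fderiv ℝ (normalisedPressure (u τ)) x (u τ x))) = 0 := by
    intro τ hτ
    have hfun : (fun x => max (1 - c / ‖u τ x‖) 0 *
        (fderiv ℝ (normalisedPressure (u τ)) x (u τ x))) = fun _ => 0 := by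
      funext x
      by_cases hu : u τ x = 0
      · rw [hu, map_zero, mul_zero]
      · have hpos : 0 < ‖u τ x‖ := norm_pos_iff.2 hu
        have hlt : 1 < c / ‖u τ x‖ := (one_lt_div hpos).2 (h τ hτ x)
        rw [max_eq_right (by linarith), zero_mul]
    rw [hfun, integral_zero]
  unfold pressureWork
  rw [setIntegral_congr_fun measurableSet_Ioo hinner, integral_zero, neg_zero]

/-- Both RHS factors are nonnegative. -/
theorem rhs_nonneg (a b : ℝ) : 0 ≤ Real.sqrt a * Real.sqrt b :=
  mul_nonneg (Real.sqrt_nonneg _) (Real.sqrt_nonneg _)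

theorem highSetMeasure_nonneg (u : ℝ → ℝ³ → ℝ³) (c T : ℝ) : 0 ≤ highSetMeasure u c T :=
  ENNReal.toReal_nonneg

theorem speedDissipation_nonneg (u : ℝ → ℝ³ → ℝ³) (c T : ℝ) : 0 ≤ speedDissipation u c T :=
  ENNReal.toReal_nonneg

/-! ## §1 The exponent is not load-bearing modulo an a priori speed bound -/

/-- A uniform a priori bound on the speed of the data class `(ν, T, E₀, B₀)`:
`‖u(t, x)‖ ≤ G(E₀, B₀)` on `[0, T) × ℝ³` for every classical Leray–Hopf solution from a rapidly
decaying datum with `∫|u₀|² ≤ E₀`, `|u₀| ≤ B₀` — uniform quantitative regularity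
(Tao 2013, Localisation and compactness, §1: qualitative ⇔ quantitative conjectures). -/
def APrioriSpeedBound (ν T : ℝ) (G : ℝ → ℝ → ℝ) : Prop :=
  ∀ (u : ℝ → ℝ³ → ℝ³) (p : ℝ → ℝ³ → ℝ),
    IsClassicalNSSolutionOn (Set.Ico 0 T) ν 0 u p → IsLerayHopfOn T ν 0 (u 0) u →
    HasRapidSpatialDecay (u 0) →
    ∀ (E₀ B₀ : ℝ), (∫ x, ‖u 0 x‖ ^ 2) ≤ E₀ → (∀ x, ‖u 0 x‖ ≤ B₀) →
    ∀ t ∈ Set.Ico 0 T, ∀ x, ‖u t x‖ ≤ G E₀ B₀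

/-- **Exponent collapse.** Under an a priori speed bound `G`, the crux with ANY exponent
`m₀ ≥ 0` and modulus `F` implies the crux with exponent `0` and modulus
`F⁺ · (2 G⁺ + 1)^{m₀}`: above `M* = 2G⁺ + 1` the level sets are empty, below it `M^{m₀} ≤ M*^{m₀}`. -/
theorem hspwWith_exponent_collapse {ν T m₀ : ℝ} (hm₀ : 0 ≤ m₀) {F G : ℝ → ℝ → ℝ}
    (hG : APrioriSpeedBound ν T G) (h : HSPWWith ν T m₀ F) :
    HSPWWith ν T 0 (fun E₀ B₀ => max (F E₀ B₀) 0 * (2 * max (G E₀ B₀) 0 + 1) ^ m₀) := by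
  intro u p hcl hLH hdec E₀ B₀ hE hB M c t hM hMc hcM hc ht
  set Ms : ℝ := 2 * max (G E₀ B₀) 0 + 1 with hMs
  have hMs1 : 0 < Ms := by rw [hMs]; positivity
  rcases le_or_gt M Ms with hle | hgt
  · -- nontrivial range: absorb `M ^ m₀ ≤ Ms ^ m₀`
    have hM0 : 0 ≤ M := le_trans hc.le hcM
    have key := h u p hcl hLH hdec E₀ B₀ hE hB M c t hM hMc hcM hc ht
    refine key.trans (mul_le_mul_of_nonneg_right (Real.sqrt_le_sqrt ?_) (Real.sqrt_nonneg _))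
    rw [Real.rpow_zero, mul_one]
    have hV := highSetMeasure_nonneg u c T
    have h1 : F E₀ B₀ * M ^ m₀ ≤ max (F E₀ B₀) 0 * Ms ^ m₀ :=
      calc F E₀ B₀ * M ^ m₀ ≤ max (F E₀ B₀) 0 * M ^ m₀ :=
            mul_le_mul_of_nonneg_right (le_max_left _ _) (Real.rpow_nonneg hM0 _)
        _ ≤ max (F E₀ B₀) 0 * Ms ^ m₀ :=
            mul_le_mul_of_nonneg_left (Real.rpow_le_rpow hM0 hle hm₀) (le_max_right _ _)
    exact mul_le_mul_of_nonneg_right h1 hV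
  · -- above `Ms`: the level sets are empty on `[0, T)`, the pressure work vanishes
    have hspeed : ∀ τ ∈ Set.Ioo 0 t, ∀ x, ‖u τ x‖ < c := by
      intro τ hτ x
      have hτ' : τ ∈ Set.Ico 0 T := ⟨hτ.1.le, hτ.2.trans ht.2⟩
      have h1 := hG u p hcl hLH hdec E₀ B₀ hE hB τ hτ' x
      have h2 : G E₀ B₀ ≤ max (G E₀ B₀) 0 := le_max_left _ _
      linarith
    rw [pressureWork_eq_zero_of_speed_lt hspeed]
    exact rhs_nonneg _ _

/-- The class-level form: a priori speed bounds on every fibre turn the crux with any fixed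
exponent `m₀ ≥ 0` (in particular the dimensional `m₀ = 4`) into `HighSpeedPressureWork`. -/
theorem highSpeedPressureWork_of_aprioriSpeedBound {m₀ : ℝ} (hm₀ : 0 ≤ m₀)
    (hG : ∀ ν T : ℝ, 0 < ν → 0 < T → ∃ G, APrioriSpeedBound ν T G)
    (h : ∀ ν T : ℝ, 0 < ν → 0 < T → ∃ F, HSPWWith ν T m₀ F) : HighSpeedPressureWork := by
  rw [highSpeedPressureWork_iff]
  intro ν T hν hT
  obtain ⟨G, hG'⟩ := hG ν T hν hT
  obtain ⟨F, hF⟩ := h ν T hν hT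
  exact ⟨0, by norm_num, _, hspwWith_exponent_collapse hm₀ hG' hF⟩

/-- Negative reading of §1 (the form landed on the `Negative/` lane): a counterexample to the
crux on a data class with an a priori speed bound kills EVERY exponent, the "generic" `m = 4`
included — there is no intermediate, weaker-but-true exponent to retreat to. -/
theorem not_hspwWith_any_exponent_of_not {m₀ : ℝ} (hm₀ : 0 ≤ m₀)
    (hG : ∀ ν T : ℝ, 0 < ν → 0 < T → ∃ G, APrioriSpeedBound ν T G)
    (hneg : ¬ HighSpeedPressureWork) :
    ¬ ∀ ν T : ℝ, 0 < ν → 0 < T → ∃ F, HSPWWith ν T m₀ F :=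
  fun h => hneg (highSpeedPressureWork_of_aprioriSpeedBound hm₀ hG h)

/-! ## §2 Leray similarity: scaling laws of the three functionals and tightness of the modulus -/

section Scaling

variable {u : ℝ → ℝ³ → ℝ³} {l : ℝ}

/-- Change of variables `y ↦ l y` in a Lebesgue integral over `ℝ³` (`l > 0`). -/
private theorem lintegral_comp_smul₃ (f : ℝ³ → ℝ≥0∞) (hl : 0 < l) :
    ∫⁻ y, f (l • y) = ENNReal.ofReal ((l ^ 3)⁻¹) * ∫⁻ x, f x := by
  have hl0 : l ≠ 0 := hl.ne'
  let e : ℝ³ ≃ᵐ ℝ³ := (Homeomorph.smul (isUnit_iff_ne_zero.2 hl0).unit).toMeasurableEquiv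
  have he : (e : ℝ³ → ℝ³) = fun x => l • x := rfl
  calc ∫⁻ y, f (l • y) = ∫⁻ y, f y ∂(Measure.map (fun x => l • x) volume) := by
        rw [← he, lintegral_map_equiv]; rfl
    _ = ENNReal.ofReal ((l ^ 3)⁻¹) * ∫⁻ x, f x := by
        rw [Measure.map_addHaar_smul volume hl0, lintegral_smul_measure,
          finrank_euclideanSpace_fin, abs_of_nonneg (by positivity), smul_eq_mul]

/-- The pressure slice of the rescaled field: `p̃[(nsRescale l u) τ] = l² p̃[u(l²τ)] ∘ (l ·)`. -/
theorem normalisedPressure_nsRescale_slice (u : ℝ → ℝ³ → ℝ³) (hl : 0 < l) (τ : ℝ) :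
    normalisedPressure (nsRescale l u τ) =
      fun y => l ^ 2 * normalisedPressure (u (l ^ 2 * τ)) (l • y) := by
  funext y
  have h1 : nsRescale l u τ = fun y => l • u (l ^ 2 * τ) (0 + l • y) := by
    funext z; simp
  rw [h1, normalisedPressure_smul_comp_affine (u (l ^ 2 * τ)) 0 l hl y, zero_add]

/-- The integrand of the pressure work rescales by `l⁴` (slice by slice, pointwise; the junk
branches of `fderiv` and of `c / 0` are covariant). -/
theorem pressureWork_integrand_nsRescale (u : ℝ → ℝ³ → ℝ³) (hl : 0 < l) (c τ : ℝ) :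
    (fun y => max (1 - l * c / ‖nsRescale l u τ y‖) 0 *
        (fderiv ℝ (normalisedPressure (nsRescale l u τ)) y (nsRescale l u τ y))) =
      fun y => l ^ 4 * (max (1 - c / ‖u (l ^ 2 * τ) (l • y)‖) 0 *
        (fderiv ℝ (normalisedPressure (u (l ^ 2 * τ))) (l • y) (u (l ^ 2 * τ) (l • y)))) := by
  have hl0 : l ≠ 0 := hl.ne'
  funext y
  have hW : max (1 - l * c / ‖nsRescale l u τ y‖) 0 = max (1 - c / ‖u (l ^ 2 * τ) (l • y)‖) 0 := by
    rw [nsRescale_apply, norm_smul, Real.norm_eq_abs, abs_of_pos hl, mul_div_mul_left _ _ hl0]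
  have hD : fderiv ℝ (normalisedPressure (nsRescale l u τ)) y =
      (l ^ 2 * l) • fderiv ℝ (normalisedPressure (u (l ^ 2 * τ))) (l • y) := by
    rw [normalisedPressure_nsRescale_slice u hl τ,
      show (fun y => l ^ 2 * normalisedPressure (u (l ^ 2 * τ)) (l • y)) =
        (l ^ 2) • (fun y => normalisedPressure (u (l ^ 2 * τ)) (l • y)) from rfl,
      fderiv_const_smul_field, Pi.smul_apply, fderiv_comp_smul, smul_smul]
  rw [hW, hD, nsRescale_apply, FunLike.coe_smul, Pi.smul_apply, map_smul, smul_eq_mul,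
    smul_eq_mul]
  ring

/-- **Scaling law of the pressure work**: `PW[u_l]_{lc}(t/l²) = l⁻¹ PW[u]_c(t)`. -/
theorem pressureWork_nsRescale (u : ℝ → ℝ³ → ℝ³) (hl : 0 < l) (c t : ℝ) :
    pressureWork (nsRescale l u) (l * c) (t / l ^ 2) = l⁻¹ * pressureWork u c t := by
  have hl0 : l ≠ 0 := hl.ne'
  have hl2 : 0 < l ^ 2 := by positivity
  set g : ℝ → ℝ := fun σ => ∫ x, max (1 - c / ‖u σ x‖) 0 *
    (fderiv ℝ (normalisedPressure (u σ)) x (u σ x)) with hg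
  have hI : (fun τ => ∫ y, max (1 - l * c / ‖nsRescale l u τ y‖) 0 *
      (fderiv ℝ (normalisedPressure (nsRescale l u τ)) y (nsRescale l u τ y))) =
      fun τ => l * g (l ^ 2 * τ) := by
    funext τ
    rw [pressureWork_integrand_nsRescale u hl c τ, integral_const_mul,
      Measure.integral_comp_smul volume
        (fun x => max (1 - c / ‖u (l ^ 2 * τ) x‖) 0 *
          (fderiv ℝ (normalisedPressure (u (l ^ 2 * τ))) x (u (l ^ 2 * τ) x))) l,
      finrank_euclideanSpace_fin, abs_of_nonneg (by positivity), smul_eq_mul, hg]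
    field_simp
  unfold pressureWork
  rw [hI, setIntegral_Ioo_comp_const_mul (fun σ => l * g σ) hl2 0 (t / l ^ 2), mul_zero,
    mul_div_cancel₀ t hl2.ne', integral_const_mul, smul_eq_mul, hg]
  field_simp

/-- The super-level set of the rescaled slice is the dilated super-level set. -/
theorem highSet_nsRescale (u : ℝ → ℝ³ → ℝ³) (hl : 0 < l) (c τ : ℝ) :
    {y : ℝ³ | l * c < ‖nsRescale l u τ y‖} = (fun y => l • y) ⁻¹' {x | c < ‖u (l ^ 2 * τ) x‖} := by
  ext y
  simp only [mem_setOf_eq, mem_preimage, nsRescale_apply, norm_smul, Real.norm_eq_abs,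
    abs_of_pos hl]
  exact ⟨fun h => lt_of_mul_lt_mul_left h hl.le, fun h => mul_lt_mul_of_pos_left h hl⟩

/-- **Scaling law of the high-set measure**: `V[u_l]_{lc}(T/l²) = l⁻⁵ V[u]_c(T)`. -/
theorem highSetMeasure_nsRescale (u : ℝ → ℝ³ → ℝ³) (hl : 0 < l) (c T : ℝ) :
    highSetMeasure (nsRescale l u) (l * c) (T / l ^ 2) = (l ^ 5)⁻¹ * highSetMeasure u c T := by
  have hl0 : l ≠ 0 := hl.ne'
  have hl2 : 0 < l ^ 2 := by positivity
  unfold highSetMeasure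
  have hV : (fun τ => volume {y : ℝ³ | l * c < ‖nsRescale l u τ y‖}) =
      fun τ => ENNReal.ofReal ((l ^ 3)⁻¹) * volume {x | c < ‖u (l ^ 2 * τ) x‖} := by
    funext τ
    rw [highSet_nsRescale u hl c τ, Measure.addHaar_preimage_smul volume hl0,
      finrank_euclideanSpace_fin, abs_of_nonneg (by positivity)]
  rw [hV, lintegral_const_mul' _ _ ENNReal.ofReal_ne_top,
    setLIntegral_Ioo_comp_const_mul (fun σ => volume {x | c < ‖u σ x‖}) hl2 0 (T / l ^ 2),
    mul_zero, mul_div_cancel₀ T hl2.ne', ENNReal.toReal_mul, ENNReal.toReal_mul,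
    ENNReal.toReal_ofReal (by positivity), ENNReal.toReal_ofReal (by positivity)]
  field_simp

/-- The speed of the rescaled slice and its gradient. -/
theorem fderiv_speed_nsRescale (u : ℝ → ℝ³ → ℝ³) (hl : 0 < l) (τ : ℝ) (y : ℝ³) :
    ‖fderiv ℝ (fun z => ‖nsRescale l u τ z‖) y‖ ^ 2 =
      l ^ 4 * ‖fderiv ℝ (fun x => ‖u (l ^ 2 * τ) x‖) (l • y)‖ ^ 2 := by
  set N : ℝ³ → ℝ := fun x => ‖u (l ^ 2 * τ) x‖ with hN
  have h1 : (fun z => ‖nsRescale l u τ z‖) = l • (fun z => N (l • z)) := by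
    funext z
    simp [hN, norm_smul, abs_of_pos hl]
  rw [h1, fderiv_const_smul_field, Pi.smul_apply, fderiv_comp_smul, smul_smul, norm_smul,
    Real.norm_eq_abs, abs_of_pos (mul_pos hl hl)]
  ring

/-- **Scaling law of the level-set dissipation**: `D[u_l]_{lc}(T/l²) = l⁻¹ D[u]_c(T)`. -/
theorem speedDissipation_nsRescale (u : ℝ → ℝ³ → ℝ³) (hl : 0 < l) (c T : ℝ) :
    speedDissipation (nsRescale l u) (l * c) (T / l ^ 2) = l⁻¹ * speedDissipation u c T := by
  have hl0 : l ≠ 0 := hl.ne'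
  have hl2 : 0 < l ^ 2 := by positivity
  unfold speedDissipation
  have hS : (fun τ => ∫⁻ y, Set.indicator {y : ℝ³ | l * c < ‖nsRescale l u τ y‖}
      (fun y => ENNReal.ofReal (‖fderiv ℝ (fun z => ‖nsRescale l u τ z‖) y‖ ^ 2)) y) =
      fun τ => ENNReal.ofReal ((l ^ 3)⁻¹) * (ENNReal.ofReal (l ^ 4) *
        ∫⁻ x, Set.indicator {x | c < ‖u (l ^ 2 * τ) x‖}
          (fun x => ENNReal.ofReal (‖fderiv ℝ (fun z => ‖u (l ^ 2 * τ) z‖) x‖ ^ 2)) x) := by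
    funext τ
    have hpt : (fun y => Set.indicator {y : ℝ³ | l * c < ‖nsRescale l u τ y‖}
        (fun y => ENNReal.ofReal (‖fderiv ℝ (fun z => ‖nsRescale l u τ z‖) y‖ ^ 2)) y) =
        fun y => (Set.indicator {x | c < ‖u (l ^ 2 * τ) x‖}
          (fun x => ENNReal.ofReal (l ^ 4) *
            ENNReal.ofReal (‖fderiv ℝ (fun z => ‖u (l ^ 2 * τ) z‖) x‖ ^ 2))) (l • y) := by
      funext y
      rw [highSet_nsRescale u hl c τ, ← Set.indicator_comp_right (fun y : ℝ³ => l • y)]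
      congr 1
      funext z
      simp only [Function.comp_apply]
      rw [fderiv_speed_nsRescale u hl τ z, ENNReal.ofReal_mul (by positivity)]
    rw [hpt, lintegral_comp_smul₃ _ hl]
    congr 1
    rw [← lintegral_const_mul' _ _ ENNReal.ofReal_ne_top]
    congr 1
    funext x
    rw [Set.indicator_const_mul]
  rw [hS, lintegral_const_mul' _ _ ENNReal.ofReal_ne_top, lintegral_const_mul' _ _ ENNReal.ofReal_ne_top,
    setLIntegral_Ioo_comp_const_mul (fun σ => ∫⁻ x, Set.indicator {x | c < ‖u σ x‖}
      (fun x => ENNReal.ofReal (‖fderiv ℝ (fun z => ‖u σ z‖) x‖ ^ 2)) x) hl2 0 (T / l ^ 2),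
    mul_zero, mul_div_cancel₀ T hl2.ne', ENNReal.toReal_mul, ENNReal.toReal_mul,
    ENNReal.toReal_mul, ENNReal.toReal_ofReal (by positivity),
    ENNReal.toReal_ofReal (by positivity), ENNReal.toReal_ofReal (by positivity)]
  field_simp

/-- The time set of the rescaled solution: `(l² ·)⁻¹' [0, l²T) = [0, T)`. -/
theorem preimage_mul_Ico (hl : 0 < l) (T : ℝ) :
    (fun t => l ^ 2 * t) ⁻¹' Set.Ico 0 (l ^ 2 * T) = Set.Ico 0 T := by
  have hl2 : 0 < l ^ 2 := by positivity
  ext s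
  simp only [Set.mem_preimage, Set.mem_Ico]
  constructor
  · rintro ⟨h1, h2⟩
    exact ⟨le_of_mul_le_mul_left (by rw [mul_zero]; exact h1) hl2, lt_of_mul_lt_mul_left h2 hl2.le⟩
  · rintro ⟨h1, h2⟩
    exact ⟨mul_nonneg hl2.le h1, mul_lt_mul_of_pos_left h2 hl2⟩

/-- **The crux under Leray's similarity (tightness of the data modulus).** If `HSPWWith ν T m F`
holds and `u` is a GLOBAL classical Leray–Hopf solution from a rapidly decaying datum with
`∫|u₀|² ≤ E₀`, `|u₀| ≤ B₀`, then for every admissible level `(M, c)`, time `t ≥ 0` and scale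
`l > 0` with `t < l² T`, applying the crux to `u_l = l u(l²·, l·)` (data bounds `(E₀/l, l B₀)`,
levels `(lM, lc)`, time `t/l²`) and scaling back gives
`PW_c(t) ≤ l^{(m-4)/2} · √(F(E₀/l, lB₀) M^m V_c(l²T)) · √(D_c(l²T))`.
With `m < 4` the prefactor decays, so along the orbit the modulus must grow at least like
`F(E₀/l, lB₀) ≳ l^{4-m}` as soon as one such `u` has `PW_c(t) > 0` with `V`, `D` bounded in `T`
(the dimensional statement "with `ν` alone, `m = 4` is forced" made quantitative: the `2/3` gain
can only come from the `B₀`-dependence of `F`, `F ≳ B₀^{4-m}` at fixed `E₀B₀`). -/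
theorem hspwWith_scaling {ν T m : ℝ} {F : ℝ → ℝ → ℝ} (hT : 0 < T) (h : HSPWWith ν T m F)
    {u : ℝ → ℝ³ → ℝ³} {p : ℝ → ℝ³ → ℝ}
    (hcl : ∀ T', 0 < T' → IsClassicalNSSolutionOn (Set.Ico 0 T') ν 0 u p)
    (hLH : ∀ T', 0 < T' → IsLerayHopfOn T' ν 0 (u 0) u)
    (hdec : HasRapidSpatialDecay (u 0))
    {E₀ B₀ M c t : ℝ} (hE : (∫ x, ‖u 0 x‖ ^ 2) ≤ E₀) (hB : ∀ x, ‖u 0 x‖ ≤ B₀)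
    (hM : 2 * B₀ ≤ M) (hMc : M / 2 ≤ c) (hcM : c ≤ M) (hc : 0 < c) (ht : 0 ≤ t)
    (hl : 0 < l) (htl : t < l ^ 2 * T) :
    pressureWork u c t ≤ l ^ ((m - 4) / 2) *
      (Real.sqrt (F (E₀ / l) (l * B₀) * M ^ m * highSetMeasure u c (l ^ 2 * T)) *
        Real.sqrt (speedDissipation u c (l ^ 2 * T))) := by
  have hl0 : l ≠ 0 := hl.ne'
  have hl2 : 0 < l ^ 2 := by positivity
  have hT2 : 0 < l ^ 2 * T := mul_pos hl2 hT
  -- admissibility of the rescaled solution on the fibre `(ν, T)`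
  have hcl' : IsClassicalNSSolutionOn (Set.Ico 0 T) ν 0 (nsRescale l u) (nsRescalePressure l p) := by
    have key := IsClassicalNSSolutionOn.nsRescale_holds (hcl (l ^ 2 * T) hT2) hl
    rwa [nsRescaleForce_zero, preimage_mul_Ico hl T] at key
  have hLH' : IsLerayHopfOn T ν 0 (nsRescale l u 0) (nsRescale l u) := by
    have key := isLerayHopfOn_nsRescale (hLH (l ^ 2 * T) hT2) hl
    rw [nsRescaleForce_zero, mul_div_cancel_left₀ T hl2.ne'] at key
    rwa [nsRescale_zero_time]
  have hdec' : HasRapidSpatialDecay (nsRescale l u 0) := by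
    rw [nsRescale_zero_time]
    exact Theorems.Target.Negative.hasRapidSpatialDecay_nsRescaleData
      ((hcl T hT).contDiff_velocity ⟨le_rfl, hT⟩) hdec hl
  -- data bounds of the rescaled datum
  have hE' : (∫ x, ‖nsRescale l u 0 x‖ ^ 2) ≤ E₀ / l := by
    have h1 : (fun x => ‖nsRescale l u 0 x‖ ^ 2) = fun x => l ^ 2 * ‖u 0 (l • x)‖ ^ 2 := by
      funext x
      rw [nsRescale_apply, mul_zero, norm_smul, Real.norm_eq_abs, abs_of_pos hl, mul_pow]
    rw [h1, integral_const_mul, Measure.integral_comp_smul volume (fun z => ‖u 0 z‖ ^ 2) l,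
      finrank_euclideanSpace_fin, abs_of_nonneg (by positivity), smul_eq_mul,
      show l ^ 2 * ((l ^ 3)⁻¹ * ∫ z, ‖u 0 z‖ ^ 2) = (∫ z, ‖u 0 z‖ ^ 2) / l by field_simp]
    exact div_le_div_of_nonneg_right hE hl.le
  have hB' : ∀ x, ‖nsRescale l u 0 x‖ ≤ l * B₀ := fun x => by
    rw [nsRescale_apply, mul_zero, norm_smul, Real.norm_eq_abs, abs_of_pos hl]
    exact mul_le_mul_of_nonneg_left (hB (l • x)) hl.le
  -- the crux applied to the rescaled solution at levels `(lM, lc)` and time `t/l²`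
  have h1 := mul_le_mul_of_nonneg_left hM hl.le
  have h2 := mul_le_mul_of_nonneg_left hMc hl.le
  have h3 := mul_le_mul_of_nonneg_left hcM hl.le
  have key := h _ _ hcl' hLH' hdec' (E₀ / l) (l * B₀) hE' hB' (l * M) (l * c) (t / l ^ 2)
    (by linarith) (by linarith) h3 (mul_pos hl hc)
    ⟨div_nonneg ht hl2.le, (div_lt_iff₀ hl2).2 (by linarith)⟩
  rw [pressureWork_nsRescale u hl c t] at key
  have hV : highSetMeasure (nsRescale l u) (l * c) T = (l ^ 5)⁻¹ * highSetMeasure u c (l ^ 2 * T) := by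
    have := highSetMeasure_nsRescale u hl c (l ^ 2 * T)
    rwa [mul_div_cancel_left₀ T hl2.ne'] at this
  have hD : speedDissipation (nsRescale l u) (l * c) T = l⁻¹ * speedDissipation u c (l ^ 2 * T) := by
    have := speedDissipation_nsRescale u hl c (l ^ 2 * T)
    rwa [mul_div_cancel_left₀ T hl2.ne'] at this
  rw [hV, hD] at key
  -- algebra: collect the powers of `l`
  set V := highSetMeasure u c (l ^ 2 * T) with hVdef
  set D := speedDissipation u c (l ^ 2 * T) with hDdef
  set A := F (E₀ / l) (l * B₀) * M ^ m * V with hA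
  have hM0 : 0 ≤ M := le_trans hc.le hcM
  have e1 : F (E₀ / l) (l * B₀) * (l * M) ^ m * ((l ^ 5)⁻¹ * V) = l ^ (m - 5) * A := by
    rw [Real.mul_rpow hl.le hM0, Real.rpow_sub hl, Real.rpow_ofNat, hA]
    field_simp
  have e2 : Real.sqrt (l ^ (m - 5) * A) * Real.sqrt (l⁻¹ * D) =
      l ^ ((m - 6) / 2) * (Real.sqrt A * Real.sqrt D) := by
    rw [Real.sqrt_mul (Real.rpow_nonneg hl.le _), Real.sqrt_mul (inv_nonneg.2 hl.le),
      Real.sqrt_eq_rpow (l ^ (m - 5)), Real.sqrt_eq_rpow l⁻¹, ← Real.rpow_mul hl.le,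
      Real.inv_rpow hl.le, ← Real.rpow_neg hl.le,
      show l ^ ((m - 6) / 2) = l ^ ((m - 5) * (1 / 2)) * l ^ (-(1 / 2 : ℝ)) from by
        rw [← Real.rpow_add hl]; congr 1; ring]
    ring
  rw [e1, e2] at key
  have e3 : l * l ^ ((m - 6) / 2) = l ^ ((m - 4) / 2) := by
    rw [show (m - 4) / 2 = 1 + (m - 6) / 2 by ring, Real.rpow_add hl, Real.rpow_one]
  calc pressureWork u c t = l * (l⁻¹ * pressureWork u c t) := by field_simp
    _ ≤ l * (l ^ ((m - 6) / 2) * (Real.sqrt A * Real.sqrt D)) :=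
        mul_le_mul_of_nonneg_left key hl.le
    _ = l ^ ((m - 4) / 2) * (Real.sqrt A * Real.sqrt D) := by rw [← mul_assoc, e3]

/-- **An overshooting global solution** for the viscosity `ν`: a classical solution on every
`[0, T')`, Leray–Hopf on every `[0, T']`, from a rapidly decaying datum with bounds `(E₀, B₀)`,
together with an admissible event — levels `2B₀ ≤ M`, `c ∈ [M/2, M]`, a time `t ≥ 0` — at which
the pressure work on `{|u| > c}` is POSITIVE, and a common bound `K` for the space–time measure
and the level-set dissipation of `{|u| > c}` on every `[0, T')`. By the level-set energy identity
(route item `LevelSetEnergyInequality`, `PW_c(t) ≥ ½∫(|u(t)| - c)₊² + ν D_c(t)`) positivity of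
the work is the same as an OVERSHOOT of the speed above the initial maximum (`|u(t, x)| > c ≥ B₀`
somewhere), which every perturbed-Beltrami / colliding-ring datum exhibits numerically (planner's
kit j021790: overshoot to `1.51 B₀`); the bound `K` holds for any global solution whose speed
eventually stays below `c` (energy inequality for `D`, Chebyshev for `V`). Not constructible in
the tree (no non-trivial global classical solution on `ℝ³` is), hence carried as a hypothesis. -/
def OvershootingGlobalSolution (ν : ℝ) (u : ℝ → ℝ³ → ℝ³) (p : ℝ → ℝ³ → ℝ)
    (E₀ B₀ M c t K : ℝ) : Prop :=
  (∀ T', 0 < T' → IsClassicalNSSolutionOn (Set.Ico 0 T') ν 0 u p) ∧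
  (∀ T', 0 < T' → IsLerayHopfOn T' ν 0 (u 0) u) ∧ HasRapidSpatialDecay (u 0) ∧
  (∫ x, ‖u 0 x‖ ^ 2) ≤ E₀ ∧ (∀ x, ‖u 0 x‖ ≤ B₀) ∧
  2 * B₀ ≤ M ∧ M / 2 ≤ c ∧ c ≤ M ∧ 0 < c ∧ 0 ≤ t ∧ 0 < pressureWork u c t ∧
  (∀ T', highSetMeasure u c T' ≤ K) ∧ (∀ T', speedDissipation u c T' ≤ K)

/-- `H_overshoot(ν)`: some overshooting global solution exists at viscosity `ν`.
TRUE ON PAPER (so the lemmas below are not "modulo False"): take a Schwartz div-free `u₀` whose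
speed has a FLAT global maximum at `x*` (`∇u₀(x*) = 0` and `Δ|u₀|²(x*) = 0`, e.g. `|u₀|² = B₀² -
O(|x - x*|⁴)`), small in `Ḣ^{1/2}` so that the classical solution is global and decays
(Fujita–Kato; smallness is a dilation/amplitude choice that does not affect the local geometry).
At `t = 0`, `∂ₜ|u|²(x*) = 2u·(-u·∇u - ∇p + νΔu) = -2u₀·∇p̃₀(x*)` (the transport term is
`u·∇|u|² = 0` at the maximum, `2νu·Δu = νΔ|u|² - 2ν|∇u|² = 0` there), and `p̃` is EVEN under
`u₀ ↦ -u₀` while `u₀(x*)` is odd: unless `u₀·∇p̃₀(x*) = 0` (non-generic), one of `±u₀` is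
accelerated at its maximum, its speed exceeds `B₀ = max|u₀|` for small `t > 0`, and by the
level-set identity `PW_{B₀}(t) ≥ ½∫(|u(t)| - B₀)₊² > 0` (levels `M = 2B₀`, `c = B₀` admissible);
decay gives `|u| < B₀` after some `T₁`, whence the bounds `K` (Chebyshev for `V`, energy for `D`).
Formalising this needs small-data global regularity + short-time asymptotics of `p̃` — out of
reach of the tree today, hence a hypothesis. -/
def OvershootExists (ν : ℝ) : Prop :=
  ∃ (u : ℝ → ℝ³ → ℝ³) (p : ℝ → ℝ³ → ℝ) (E₀ B₀ M c t K : ℝ),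
    OvershootingGlobalSolution ν u p E₀ B₀ M c t K

/-- **Refutation of the data-uniform strengthening (modulo `H_overshoot`).** For `m < 4`, NO
constant modulus `F ≡ C` can work on any fibre `(ν, T)` once a single overshooting global solution
exists at viscosity `ν`: rescaling it by `l → ∞` keeps it admissible on `[0, T)` with data bounds
`(E₀/l, lB₀)` — invisible to a constant `F` — while the inequality acquires the factor
`l^{(m-4)/2} → 0` (`hspwWith_scaling`). So the data modulus `F(E₀, B₀)` of the crux is
load-bearing in an essential, `B₀`-sensitive way: any proof must let `F` grow at least like
`B₀^{4-m}` along scaling orbits. -/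
theorem not_hspwWith_const_of_overshoot {ν T m C : ℝ} (hT : 0 < T) (hm : m < 4)
    (hO : OvershootExists ν) : ¬ HSPWWith ν T m (fun _ _ => C) := by
  intro h
  obtain ⟨u, p, E₀, B₀, M, c, t, K, hcl, hLH, hdec, hE, hB, hM, hMc, hcM, hc, ht, hPW, hVK, hDK⟩ :=
    hO
  have hM0 : 0 ≤ M := le_trans hc.le hcM
  set Q : ℝ := Real.sqrt (|C| * M ^ m * K) * Real.sqrt K with hQ
  -- along `l → ∞`: eventually `0 < l`, `t < l² T` and `l^{(m-4)/2} Q < PW`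
  have ev1 : ∀ᶠ l : ℝ in atTop, 0 < l := eventually_gt_atTop 0
  have ev2 : ∀ᶠ l : ℝ in atTop, t < l ^ 2 * T :=
    ((tendsto_pow_atTop two_ne_zero).atTop_mul_const hT).eventually_gt_atTop t
  have hlim : Tendsto (fun l : ℝ => l ^ ((m - 4) / 2) * Q) atTop (𝓝 0) := by
    have e : (fun l : ℝ => l ^ ((m - 4) / 2) * Q) = fun l => l ^ (-((4 - m) / 2)) * Q := by
      funext l; congr 2; ring
    rw [e, ← zero_mul Q]
    exact (tendsto_rpow_neg_atTop (by linarith)).mul_const Q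
  have ev3 : ∀ᶠ l : ℝ in atTop, l ^ ((m - 4) / 2) * Q < pressureWork u c t :=
    hlim.eventually_lt_const hPW
  obtain ⟨l, hl, htl, hlt⟩ := (ev1.and (ev2.and ev3)).exists
  have key := hspwWith_scaling hT h hcl hLH hdec hE hB hM hMc hcM hc ht hl htl
  -- bound the data of the orbit by `K`
  have hbd : Real.sqrt (C * M ^ m * highSetMeasure u c (l ^ 2 * T)) *
      Real.sqrt (speedDissipation u c (l ^ 2 * T)) ≤ Q := by
    refine mul_le_mul (Real.sqrt_le_sqrt ?_) (Real.sqrt_le_sqrt (hDK _)) (Real.sqrt_nonneg _)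
      (Real.sqrt_nonneg _)
    calc C * M ^ m * highSetMeasure u c (l ^ 2 * T)
        ≤ |C| * M ^ m * highSetMeasure u c (l ^ 2 * T) :=
          mul_le_mul_of_nonneg_right (mul_le_mul_of_nonneg_right (le_abs_self C)
            (Real.rpow_nonneg hM0 _)) (highSetMeasure_nonneg _ _ _)
      _ ≤ |C| * M ^ m * K :=
          mul_le_mul_of_nonneg_left (hVK _) (mul_nonneg (abs_nonneg C) (Real.rpow_nonneg hM0 _))
  have : pressureWork u c t ≤ l ^ ((m - 4) / 2) * Q :=
    key.trans (mul_le_mul_of_nonneg_left hbd (Real.rpow_nonneg hl.le _))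
  linarith


/-- **Quantitative tightness of the modulus along a scaling orbit.** In the situation of
`OvershootingGlobalSolution` (bounds `K` on `V`, `D` along the orbit), any admissible modulus
satisfies `PW_c(t)² ≤ l^{m-4} · |F(E₀/l, lB₀)| · M^m · K²` for every `l > 0` with `t < l²T`, i.e.
`|F(E₀/l, l B₀)| ≥ l^{4-m} · PW_c(t)² / (M^m K²)`: at fixed `E₀B₀` the modulus grows at least like
`B₀^{4-m}` — for `m < 10/3` at least like `B₀^{2/3}`. -/
theorem modulus_lower_bound_of_overshoot {ν T m : ℝ} {F : ℝ → ℝ → ℝ} (hT : 0 < T)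
    (h : HSPWWith ν T m F) {u : ℝ → ℝ³ → ℝ³} {p : ℝ → ℝ³ → ℝ} {E₀ B₀ M c t K : ℝ}
    (hO : OvershootingGlobalSolution ν u p E₀ B₀ M c t K) (hl : 0 < l) (htl : t < l ^ 2 * T) :
    pressureWork u c t ^ 2 ≤ l ^ (m - 4) * (|F (E₀ / l) (l * B₀)| * M ^ m * K * K) := by
  obtain ⟨hcl, hLH, hdec, hE, hB, hM, hMc, hcM, hc, ht, hPW, hVK, hDK⟩ := hO
  have hM0 : 0 ≤ M := le_trans hc.le hcM
  have hK : 0 ≤ K := (highSetMeasure_nonneg u c 0).trans (hVK 0)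
  set a : ℝ := |F (E₀ / l) (l * B₀)| * M ^ m * K with ha
  have ha0 : 0 ≤ a := by rw [ha]; positivity
  have key := hspwWith_scaling hT h hcl hLH hdec hE hB hM hMc hcM hc ht hl htl
  have hbd : Real.sqrt (F (E₀ / l) (l * B₀) * M ^ m * highSetMeasure u c (l ^ 2 * T)) *
      Real.sqrt (speedDissipation u c (l ^ 2 * T)) ≤ Real.sqrt a * Real.sqrt K := by
    refine mul_le_mul (Real.sqrt_le_sqrt ?_) (Real.sqrt_le_sqrt (hDK _)) (Real.sqrt_nonneg _)
      (Real.sqrt_nonneg _)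
    calc F (E₀ / l) (l * B₀) * M ^ m * highSetMeasure u c (l ^ 2 * T)
        ≤ |F (E₀ / l) (l * B₀)| * M ^ m * highSetMeasure u c (l ^ 2 * T) :=
          mul_le_mul_of_nonneg_right (mul_le_mul_of_nonneg_right (le_abs_self _)
            (Real.rpow_nonneg hM0 _)) (highSetMeasure_nonneg _ _ _)
      _ ≤ |F (E₀ / l) (l * B₀)| * M ^ m * K :=
          mul_le_mul_of_nonneg_left (hVK _) (mul_nonneg (abs_nonneg _) (Real.rpow_nonneg hM0 _))
  have h1 : pressureWork u c t ≤ l ^ ((m - 4) / 2) * (Real.sqrt a * Real.sqrt K) :=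
    key.trans (mul_le_mul_of_nonneg_left hbd (Real.rpow_nonneg hl.le _))
  have h2 := pow_le_pow_left₀ hPW.le h1 2
  have e : (l ^ ((m - 4) / 2) * (Real.sqrt a * Real.sqrt K)) ^ 2 = l ^ (m - 4) * (a * K) := by
    rw [mul_pow, mul_pow, Real.sq_sqrt ha0, Real.sq_sqrt hK, ← Real.rpow_natCast,
      ← Real.rpow_mul hl.le]
    norm_num
  rw [e, ha] at h2
  linarith [h2]

/-- The crux-shaped DATA-UNIFORM strengthening: one constant per fibre `(ν, T)`. -/
def UniformHighSpeedPressureWork (m : ℝ) : Prop :=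
  ∀ (ν T : ℝ), 0 < ν → 0 < T → ∃ C : ℝ, HSPWWith ν T m (fun _ _ => C)

/-- **The uniform strengthening is false for every `m < 4` modulo one overshooting global
solution** (at any positive viscosity). In particular "`m < 10/3` with an absolute constant" —
the exponent gain WITHOUT the data modulus — is not a weaker true statement to aim for. -/
theorem not_uniformHighSpeedPressureWork {m : ℝ} (hm : m < 4)
    (hO : ∃ ν, 0 < ν ∧ OvershootExists ν) : ¬ UniformHighSpeedPressureWork m := by
  rintro h
  obtain ⟨ν, hν, hO⟩ := hO
  obtain ⟨C, hC⟩ := h ν 1 hν one_pos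
  exact not_hspwWith_const_of_overshoot one_pos hm hO hC


end Scaling


/-! ## §3 Why it resists — near-misses (paper analysis, cycle 1)

All candidate counterexample mechanisms at FIXED data bounds `(E₀, B₀)` and fixed `(ν, T)` are
absorbed by the modulus `F`, because (with `§4`) the crux follows from, and morally is, a bound of
the form `PW_c(t)² ≲ sup_{{|u|>c}} |p̃ - Φ(t,|u|)|² · V_c · D_c` with `p̃ - Φ = O(s_max²)`:

* INTEGRATION BY PARTS + MODERATION (route items `ModerationIdentity`, proved, and the planner's
  stub `ModeratedCauchySchwarz`): `PW_c(t) = ∫∫ (p̃ - Φ(t,s)) (c/s²)(u·∇s) 1_{s>c}` for every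
  moderator `Φ`, hence `PW ≤ ‖(p̃ - Φ)1_{s>c}‖_{L²_{t,x}} √D_c ≤ sup|p̃ - Φ| √(V_c D_c)`. So a kill at
  bounded amplification needs the moderated pressure on the high-speed set to be UNBOUNDED relative
  to `M²` — not merely large pressure, but pressure FLUCTUATION across speed-level surfaces.
* EARLY-TIME MULTI-SCALE DATA (the only regime where the solution is "an arbitrary field"): with
  `N` disjoint dyadic shells of compactly supported div-free flows `U(2^k ·)` around the speed
  maximum `x*`, cross terms of `p̃` vanish (disjoint supports), `p̃` is dilation invariant at the
  centre, so `p̃(x*) = N · p̃[U](0)` — the BMO logarithm is attained by div-free fields with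
  `|u| ≤ B₀`. But the contribution of shell `k` varies on scale `2^{-k} ≫` (size of the overshoot
  set), so it is a function of `(t, s)` up to `o(1)` there and the moderation identity removes it:
  the effective `|p̃ - Φ|` stays `O(B₀²)`. Meanwhile the overshoot itself is `δ ≲ B₀ Re_ℓ`
  (`Re_ℓ = B₀ℓ/ν ≪ 1` at small scales; the heat part is an `L^∞` contraction, only `B(u,u)`
  accelerates), and the curvature of the speed at an accelerating maximum is `≲ B₀²/(νℓ)`, giving
  `D_c/V_c ≲ B₀⁴/ν²` — the dimensional rate, absorbed by `F(E₀, B₀)`.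
* PLATEAU / ROTATING-DIRECTION configurations (`|u| ≈ const > c`, direction turning, so the FULL
  gradient dissipation `ν∫∫(1-c/s)|∇u|² ⊂ PW` is large while `D_c` is small): dynamically
  impossible above the initial maximum, precisely because `PW ≤ sup|p̃-Φ| √(V D)` bounds the full
  level-set energy budget by the speed-gradient dissipation (r1's A4 estimate `≲ ν²c²R²`).
* SWIRL SPIN-UP / converging swirling jets / colliding rings (pressure-driven acceleration of the
  fastest fluid — the planner's own falsifier list): amplification `s_max/B₀ ≲ Re^{1/2}` (Burgers
  balance) at fixed `(E₀, B₀, ν)`; thin sheets/tubes at speed `s` have thickness `≳ ν/s`, so again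
  `D_c/V_c ≲ s_max⁴/ν²`, absorbed unless `s_max/B₀` is unbounded on the data class.
* CONCLUSION: a counterexample family needs UNBOUNDED AMPLIFICATION at fixed `(E₀, B₀, ν, T)`,
  i.e. failure of uniform quantitative regularity on the Schwartz class — the blow-up regime
  (consistent with §1: modulo `APrioriSpeedBound` every exponent is as good as any other, and with
  the route's own `LevelSetClosure`: crux ⇒ boundedness). No certified computation can produce it;
  the planner's DNS (j021790/j021926, amplification ≤ 1.51) cannot enter the relevant regime.
  Literature: no sharpness result for Vasseur's `4/3` on SOLUTIONS is in print (r1 search;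
  Vasseur 2007 App. conjectures `β > 3/2`; Tran–Yu moderation is qualitative). -/

/-! ## §4 A pressure-free necessary condition (level-set Caccioppoli form) -/

/-- **What the crux says without the pressure.** Modulo the route's own support item
`LevelSetEnergyInequality` (Vasseur's Lemma 11 globalised: `∫(s-c)₊² + 2ν D_c(t) ≤ 2 PW_c(t)` for
`c` above the initial speed maximum), the crux forces, for every admissible event,
`ν D_c(t) ≤ √(F M^m V_c(T)) √(D_c(T))` — a reverse-Poincaré / Caccioppoli inequality for the
SPEED on its own super-level sets: the level-set dissipation above the initial maximum is
controlled by `M^m ×` the space–time measure of the set. A disprover may attack this pressure-free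
form directly (thin fast structures: `D/V ~ (δ/ℓ)²` must stay `≲ F M^m/ν²`); §3 records why the
known mechanisms give only the dimensional `s_max⁴/ν²`. -/
theorem speedDissipation_le_of_hspwWith (hLSE : LevelSetEnergyInequality) {ν T m : ℝ}
    {F : ℝ → ℝ → ℝ} (hν : 0 < ν) (hT : 0 < T) (h : HSPWWith ν T m F)
    {u : ℝ → ℝ³ → ℝ³} {p : ℝ → ℝ³ → ℝ} (hcl : IsClassicalNSSolutionOn (Set.Ico 0 T) ν 0 u p)
    (hLH : IsLerayHopfOn T ν 0 (u 0) u) (hdec : HasRapidSpatialDecay (u 0))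
    {E₀ B₀ M c t : ℝ} (hE : (∫ x, ‖u 0 x‖ ^ 2) ≤ E₀) (hB : ∀ x, ‖u 0 x‖ ≤ B₀)
    (hM : 2 * B₀ ≤ M) (hMc : M / 2 ≤ c) (hcM : c ≤ M) (hc : 0 < c) (ht : t ∈ Set.Ico 0 T) :
    ν * speedDissipation u c t ≤
      Real.sqrt (F E₀ B₀ * M ^ m * highSetMeasure u c T) * Real.sqrt (speedDissipation u c T) := by
  have hcB : ∀ x, ‖u 0 x‖ ≤ c := fun x => (hB x).trans (by linarith)
  have h1 := hLSE ν T hν hT u p hcl hLH hdec c hc hcB t ht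
  have h2 := h u p hcl hLH hdec E₀ B₀ hE hB M c t hM hMc hcM hc ht
  have h3 : 0 ≤ ∫ x, (max (‖u t x‖ - c) 0) ^ 2 := integral_nonneg fun x => sq_nonneg _
  have h1' : (∫ x, (max (‖u t x‖ - c) 0) ^ 2) + 2 * ν * speedDissipation u c t ≤
      2 * pressureWork u c t := by
    unfold speedDissipation pressureWork
    linarith
  linarith

/-! ## §5 Adversary normal form -/

/-- What a kill must exhibit: one fibre `(ν, T)` on which EVERY exponent `m < 10/3` and EVERY
modulus `F` is violated by some admissible solution/event — by §2 it is enough to violate every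
`F` at ONE `m` arbitrarily close to `10/3` from below only if the violating family also defeats the
growth `F(E₀, B₀) ~ B₀^{4-m}`; by §1 a violating family on a class with a priori speed bounds
violates every exponent at once. -/
theorem not_highSpeedPressureWork_iff :
    ¬ HighSpeedPressureWork ↔
      ∃ ν T : ℝ, 0 < ν ∧ 0 < T ∧ ∀ m : ℝ, m < 10 / 3 → ∀ F : ℝ → ℝ → ℝ, ¬ HSPWWith ν T m F := by
  rw [highSpeedPressureWork_iff]
  push Not
  exact Iff.rfl

/-- Unfolding a violated fibre statement: an admissible solution and event with
`PW_c(t) > √(F M^m V_c(T)) √(D_c(T))`. -/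
theorem not_hspwWith_iff {ν T m : ℝ} {F : ℝ → ℝ → ℝ} :
    ¬ HSPWWith ν T m F ↔
      ∃ (u : ℝ → ℝ³ → ℝ³) (p : ℝ → ℝ³ → ℝ),
        IsClassicalNSSolutionOn (Set.Ico 0 T) ν 0 u p ∧ IsLerayHopfOn T ν 0 (u 0) u ∧
        HasRapidSpatialDecay (u 0) ∧
        ∃ E₀ B₀ : ℝ, (∫ x, ‖u 0 x‖ ^ 2) ≤ E₀ ∧ (∀ x, ‖u 0 x‖ ≤ B₀) ∧
        ∃ M c t : ℝ, 2 * B₀ ≤ M ∧ M / 2 ≤ c ∧ c ≤ M ∧ 0 < c ∧ t ∈ Set.Ico 0 T ∧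
        Real.sqrt (F E₀ B₀ * M ^ m * highSetMeasure u c T) * Real.sqrt (speedDissipation u c T) <
          pressureWork u c t := by
  unfold HSPWWith
  push Not
  exact Iff.rfl


/-! ## §6 Targets — line `Sketch` (idea `comoving-head-ceiling`, PICKED 2026-08-17; stubs
`stub_pressureWorkGivenPressure` ✓landed, `stub_levelSetIBP` ✓landed, `stub_sliceRegularity`,
`stub_moderatedSplit`, `stub_headCeiling`, `stub_costCauchySchwarz`, `stub_comovingBudget`)

Disprover's triage of the registered stubs (no `stuck_stubs` in the payload yet; cycle 1):

* TRUE INFRASTRUCTURE — do not attack further: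
  `stub_moderatedSplit` (checked on paper line by line: `q = (H_U - k) + [k - |v|²/2 - |U|²/2] + ⟨v,U⟩`,
  the bracket dies by the PROVED `ModerationIdentity` with `g(s) = k - s²/2 - |U|²/2`,
  `|(c/|v|²)(v·∇|v|)⟨v,U⟩| ≤ c‖U‖‖∇|v|‖`, and `(v·∇|v|)(H_U - k) ≤ (v·∇|v|)₋(k - H_U)` for
  `H_U ≤ k`); `stub_costCauchySchwarz` (Cauchy–Schwarz + finiteness of `V`, `D`, both in the tree:
  `levelSetDissipation_ne_top`, Chebyshev); `stub_headCeiling` (drift–heat maximum principle for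
  `H_U = p + |u-U|²/2`: the identity `(∂ₜ + u·∇ - νΔ)H_U = ∂ₜp + U·∇p - ν|ω|²` is exact for
  classical solutions — `∂ₜ|v|²/2 = -u·∇|v|²/2 - v·∇p + νΔ|v|²/2 - ν|∇u|²`, `v = u - U`, and
  `-νΔp - ν|∇u|² = ν(∂ᵢuⱼ∂ⱼuᵢ - ∂ᵢuⱼ∂ᵢuⱼ) = -ν|ω|²`; at spatial infinity `H_U → C(τ) + |U|²/2`
  with `C' ≤ r`, consistent with the conclusion; the stated boundedness clauses are what the
  whole-space maximum principle needs); `stub_sliceRegularity` (Tao-class slab bounds; the tree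
  already has `levelSetModeration_slabBounds`, `…_isBounded_superlevel`).
* THE OPEN STUB `stub_comovingBudget` is CRUX-COMPLETE and inherits §§1–2 verbatim: (i) its shape is
  `∃ m < 10/3, ∃ F₁ ≥ 0, … deficit-integral ≤ ½√(F₁ M^m V)√D` with an integrand supported on
  `A = {s > c}`, so modulo `APrioriSpeedBound` the exponent is again decoration (above the bound
  `A = ∅`, the integral vanishes, and `U = 0`, `K = sup H(0)`, `r = sup_x ∂ₜp` — finite on slabs —
  discharge the side conditions); (ii) under Leray's similarity the deficit integral scales like the
  pressure work (`l⁻¹`: `H_U`, `K`, `∫r` carry `l²`, the flux `(c/s²)(u·∇s)₋ dx dτ` carries `l⁻³`),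
  `c‖U‖` like `l²` against `√(F₁ (lM)^m) ~ l^{m/2}`, so `F₁` must grow like `B₀^{4-m}` along
  scaling orbits exactly as `F` (`modulus_lower_bound_of_overshoot`).
* MECHANISM-LEVEL READING of the budget (where a kill would come from). The deficit weight
  `(c/s²)(u·∇s)₋` only charges fast fluid that DECELERATES. (a) Jet-like through-flow threading a
  translating structure carries, in the comoving frame `U`, the far-field head = the ceiling:
  deficit `≈ 0` — the line's good case. (b) Swirling core fluid has head `≈ -s_max²/2` below the
  far-field ceiling (cyclostrophic deficit), i.e. deficit `~ M²` vs the allowance `½√F₁ M^{m/2}`,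
  `m/2 < 5/3`: the budget then needs the deceleration flux of fast cores to be a fraction
  `≲ √F₁ M^{m/2-2}` of `√(VD)` — exact for axisymmetric cores (`u·∇s = 0` on circular
  streamlines), so the adversarial scenario is NON-AXISYMMETRIC FAST CORES: strained/elliptic cores,
  merger and RECONNECTION of intense tubes, where the fastest fluid decelerates at `O(1)` flux
  fraction with `O(M²)` head deficit. At bounded amplification `M/B₀` this is absorbed by
  `F₁(E₀,B₀)`; it bites only along a family with unbounded amplification (blow-up regime), as for
  the crux itself. (c) FAR-FIELD CEILING PUMPING (`r ≥ sup_x(∂ₜp + U·∇p)` charges pressure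
  transients ANYWHERE to the budget of `A`): two distant pumps moving oppositely defeat any single
  `U`, but their total lift `∫r ≲ B₀² Re_pump ≤ C(E₀, B₀, ν)` is class-bounded and `M`-independent,
  hence absorbed — not a kill, but it makes the stub STRICTLY STRONGER than the crux at moderate
  `M` (a prover must pay for far-field transients the crux never sees; a localised ceiling
  `K(τ, ·)` would avoid this).
* RECOMMENDATION to the lead (negative side): the only falsifiable-now content is numerical —
  reconnection of two anti-parallel / orthogonal tubes at the largest amplification the box allows,
  measuring deficit-integral / (√(M^m V) √D) on the top levels against `M/B₀`; the existing DNS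
  (j021926, j023338/9: amplification ≤ 1.36) never reaches regime (b). -/

end Summit.NavierStokesRegularity.NavierStokesRegularity.Cruxes.HighSpeedPressureWork.Disproof

end
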